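import Summits.QuantumFields.YangMills.Theorems.Instrument.ClosedComplexExploration
import Summits.QuantumFields.YangMills.Theorems.Instrument.AdmissibleLinkComplexCount
import HarnessLib

/-!
# Instrument cell `ym-instrument`, crew (b): the tree's tail obligation `TailBoundT2` DISCHARGED — `closedCount 4 n ≤ (7/10)·(299/20)^n` for every `n` —
# and its (G1) twin T2′: the same bound for complexes connected and closed through ANY admissible-link class (part 2; part 1 = `ClosedComplexExploration`)

QUESTIONS.md: Q-B1 (A-0826-8 reading (i) REACH; certs/b radius∕rate rows of record carry `conditional_on ["T2"]` = exactly this obligation).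
Cell `run/shared/lean/pub/ym-instrument/`, HUMAN RULING D-0084 (2), director-ym R138.  HONEST FRAMING (page 1, binding).  WHAT IS CERTIFIED HERE
AND AT WHICH `(G, D, L, β)`: PURE COMBINATORICS of `ℤ⁴` (no group, no coupling, no volume): the number `closedCount 4 n` of CLOSED (every link in `≥ 2`
plaquettes), LINK-CONNECTED sets of `n` plaquettes of `ℤ⁴` through the fixed root link obeys ★ `closedCount 4 n ≤ (7/10)·((100/19)·(119/100)^6)^n
≤ (7/10)·(299/20)^n = 0.7·14.95ⁿ` for EVERY `n` — the statement of the tree's NAMED OBLIGATION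
`Balaban1983to89.StrongCouplingKPWindow.TailBoundT2` («analysis grade, NOT proved in the tree — a named `Prop` a prover may discharge»), now a
hypothesis-free kernel theorem `tailBoundT2_holds : TailBoundT2`; and, for ANY link predicate `Adm` and any root link `e` with `Adm e`, the number of
`n`-plaquette sets through `e` that are `Adm`-CONNECTED (`AdmissibleLinkComplexCount.IsAdmConnected`) and CLOSED ON THEIR ADMISSIBLE LINKS (`AdmClosed`: every
admissible link of the set in `≥ 2` of its plaquettes; other links unconstrained) obeys the same bound (`admClosedCount_le_T2`) — the typed form of sc-eng-2's
T2′ (2026-08-27T00:09:38Z) for S2-SPEC v0.5 (G1)∕(G3) once instantiated at `Adm :=` «free link of the axial-2 comb gauge» (the instantiation is the spec's).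
PROOF (the paper proof `pub-balaban/ir/data/FRONT-SC-taillemma.txt` steps (1)–(6), typed; machine = part 1): along the run of such an `X` from the initial state
(plaquettes of `X` at the root link born, root decided; only admissible links are ever decided) every block indicator is `1` (closedness on admissible links:
`c + m = deg_X(link) ≥ 2`, `card_atLink_split`), the run ends with everything born (`Adm`-connectedness, `eq_of_terminal`),
the new-born counts telescope to `n` (`U_step`) and the present counts to `≤ 3n` (potential `Φ` = undecided (plaquette, link) incidences, `≤ 4` links a
plaquette: `Φ_step`, `Φ_init_le`), whence weight `≥ x^n y^{3n}` (`wt_lower`, `W_lower`); with part 1's Kraft sum `≤ 7/10` over the finite valid family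
(`AdmissibleLinkComplexCount.dfsFamilyAt e n` filtered): `count · x^n y^{3n} ≤ 7/10` (`admClosedCount_mul_le`); `closedCount 4 n` is the case `Adm = ⊤`,
`e = rootLink 4` (`closedCount_eq_admClosedCount`).  CONSEQUENCE FOR THE CELL: every row ∕ Lean
face graded `(T | counts, T2)` (`KPCriterionSU2Conditional`, `KPCriterionSU2RateRows`: hypotheses `(hc : CountsUpTo16) (hT : TailBoundT2)`) loses `T2` by
`tailBoundT2_holds`; hypothesis-free KP rows on this tail are a separate file.  NOT a statement about any gauge theory, NOT a radius, NOT a clustering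
rate, NOT summit-bearing.  Grade (T).
-/

noncomputable section

open Finset
open Literature.MathematicalPhysics.QuantumLattice (ZdEdge ZdPlaquette plaquetteEdges plaquettesTouching)
open Literature.MathematicalPhysics.QuantumFieldTheory (mem_plaquettesTouching_singleton card_plaquettesTouching_singleton_le card_plaquetteEdges_le)
open Literature.MathematicalPhysics.QuantumFieldTheory.Balaban1983to89.StrongCouplingKPWindow
  (links IsLinkConnected IsClosedComplex rootLink closedCount TailBoundT2)
open Summit.QuantumFields.YangMills.Theorems.Instrument.AdmissibleLinkComplexCount (IsAdmConnected isLinkConnected_of_isAdmConnected dfsFamilyAt mem_dfsFamilyAt)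
open Summit.QuantumFields.YangMills.Theorems.Instrument.ClosedComplexExploration

namespace Summit.QuantumFields.YangMills.Theorems.Instrument.ClosedComplexTailBound

/-! ## §3 The run of an `Adm`-connected complex closed on its admissible links has weight `≥ x^n y^{3n}` -/

variable (Adm : ZdEdge 4 → Prop) [DecidablePred Adm]

/-- **Closed on admissible links**: every admissible link of `X` lies in at least two plaquettes of `X` (other links unconstrained).  At `Adm = ⊤` this is
the tree's `IsClosedComplex`; at `Adm =` «free link» it is S2-SPEC (G1)'s «every free link of the set in `≥ 2` of its plaquettes». [folklore] -/
def AdmClosed (X : Finset (ZdPlaquette 4)) : Prop := ∀ l ∈ links X, Adm l → 2 ≤ (atLink X l).card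

/-- The invariant of the exploration of `X` from the root link `e`: born plaquettes belong to `X`, every decided link is saturated (all plaquettes of `X`
through it are born), and `e` is decided. [folklore] -/
structure Inv (e : ZdEdge 4) (X : Finset (ZdPlaquette 4)) (s : State) : Prop where
  /-- born plaquettes belong to the target -/
  sub : s.Y ⊆ X
  /-- decided links are saturated -/
  sat : ∀ l ∈ s.D, atLink X l ⊆ s.Y
  /-- the root link is decided -/
  root : e ∈ s.D

/-- The potential: undecided (plaquette, link) incidences of the target (all links, admissible or not). [folklore] -/
def Φ (X : Finset (ZdPlaquette 4)) (s : State) : ℕ := ∑ p ∈ X, (plaquetteEdges p \ s.D).card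

/-- The unborn plaquettes of the target. [folklore] -/
def U (X : Finset (ZdPlaquette 4)) (s : State) : ℕ := (X \ s.Y).card

/-- The termination measure: undecided admissible links of the target. [folklore] -/
def μ (X : Finset (ZdPlaquette 4)) (s : State) : ℕ := ((links X).filter Adm \ s.D).card

/-- Links of a subfamily are links of the family. [folklore] -/
theorem links_mono {Y X : Finset (ZdPlaquette 4)} (h : Y ⊆ X) : links Y ⊆ links X :=
  biUnion_subset_biUnion_of_subset_left _ h

/-- **Completeness**: at a terminal state of the exploration of an `Adm`-connected `X` (invariant holding, root link a link of `X`) everything is born.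
[folklore] -/
theorem eq_of_terminal {e : ZdEdge 4} {X : Finset (ZdPlaquette 4)} {s : State} (hI : Inv e X s) (hconn : IsAdmConnected Adm X) (hroot : e ∈ links X)
    (h : und Adm s = ∅) : s.Y = X := by
  have hD : (links s.Y).filter Adm ⊆ s.D := by
    have := h; unfold und at this
    exact sdiff_eq_empty_iff_subset.1 this
  obtain ⟨p₀, hp₀X, hp₀e⟩ := mem_biUnion.1 hroot
  have hp₀ : p₀ ∈ s.Y := hI.sat _ hI.root (mem_filter.2 ⟨hp₀X, hp₀e⟩)
  refine Subset.antisymm hI.sub fun q hq => ?_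
  have hpath := hconn p₀ hp₀X q hq
  clear hq
  induction hpath with
  | refl => exact hp₀
  | @tail b c _ hbc ih =>
    obtain ⟨-, hc, l, hl, hlb, hlc⟩ := hbc
    have hlD : l ∈ s.D := hD (mem_filter.2 ⟨mem_biUnion.2 ⟨b, ih, hlb⟩, hl⟩)
    exact hI.sat l hlD (mem_filter.2 ⟨hc, hlc⟩)

/-- The invariant is preserved by a block. [folklore] -/
theorem inv_step {e : ZdEdge 4} {X : Finset (ZdPlaquette 4)} {s : State} (hI : Inv e X s) : Inv e X (step Adm s X) := by
  refine ⟨?_, ?_, ?_⟩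
  · intro p hp
    rcases mem_union.1 hp with hp | hp
    · exact hI.sub hp
    · exact (mem_sdiff.1 (mem_filter.1 hp).1).1
  · intro l hl p hp
    change p ∈ s.Y ∪ atLink (X \ s.Y) (sel (und Adm s))
    rcases mem_insert.1 hl with rfl | hl
    · by_cases hpY : p ∈ s.Y
      · exact mem_union_left _ hpY
      · exact mem_union_right _ (mem_filter.2 ⟨mem_sdiff.2 ⟨(mem_filter.1 hp).1, hpY⟩, (mem_filter.1 hp).2⟩)
    · exact mem_union_left _ (hI.sat l hl hp)
  · exact mem_insert_of_mem hI.root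

/-- At a non-terminal state the selected link is an undecided admissible link of the target. [folklore] -/
theorem sel_mem_sdiff {e : ZdEdge 4} {X : Finset (ZdPlaquette 4)} {s : State} (hI : Inv e X s) (h : und Adm s ≠ ∅) :
    sel (und Adm s) ∈ (links X).filter Adm \ s.D := by
  have hne : (und Adm s).Nonempty := nonempty_iff_ne_empty.2 h
  have hmem := sel_mem hne
  unfold und at hmem
  obtain ⟨h1, h2⟩ := mem_sdiff.1 hmem
  exact mem_sdiff.2 ⟨filter_subset_filter _ (links_mono hI.sub) h1, h2⟩

/-- The termination measure drops by one at each block. [folklore] -/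
theorem μ_step {e : ZdEdge 4} {X : Finset (ZdPlaquette 4)} {s : State} (hI : Inv e X s) (h : und Adm s ≠ ∅) :
    μ Adm X (step Adm s X) + 1 = μ Adm X s := by
  unfold μ step
  rw [sdiff_insert, card_erase_add_one (sel_mem_sdiff Adm hI h)]

/-- Unborn plaquettes: those born at the block plus those unborn after it. [folklore] -/
theorem U_step {X : Finset (ZdPlaquette 4)} {s : State} :
    U X s = (atLink (X \ s.Y) (sel (und Adm s))).card + U X (step Adm s X) := by
  unfold U step
  change (X \ s.Y).card = _ + (X \ (s.Y ∪ atLink (X \ s.Y) (sel (und Adm s)))).card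
  have hsub : atLink (X \ s.Y) (sel (und Adm s)) ⊆ X \ s.Y := filter_subset _ _
  rw [show X \ (s.Y ∪ atLink (X \ s.Y) (sel (und Adm s))) = (X \ s.Y) \ atLink (X \ s.Y) (sel (und Adm s)) from sdiff_sdiff_left.symm,
    card_sdiff_of_subset hsub]
  have : (atLink (X \ s.Y) (sel (und Adm s))).card ≤ (X \ s.Y).card := card_le_card hsub
  omega

/-- The potential drops at a block by the degree of the decided link in the target. [folklore] -/
theorem Φ_step {e : ZdEdge 4} {X : Finset (ZdPlaquette 4)} {s : State} (hI : Inv e X s) (h : und Adm s ≠ ∅) :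
    Φ X s = (atLink X (sel (und Adm s))).card + Φ X (step Adm s X) := by
  have hl : sel (und Adm s) ∉ s.D := (mem_sdiff.1 (sel_mem_sdiff Adm hI h)).2
  unfold Φ step
  change _ = _ + ∑ p ∈ X, (plaquetteEdges p \ insert (sel (und Adm s)) s.D).card
  rw [card_filter, ← sum_add_distrib]
  refine sum_congr rfl fun p _ => ?_
  rw [sdiff_insert]
  by_cases hp : sel (und Adm s) ∈ plaquetteEdges p
  · rw [if_pos hp, ← card_erase_add_one (mem_sdiff.2 ⟨hp, hl⟩)]; ring
  · rw [if_neg hp, erase_eq_of_notMem (fun hm => hp (mem_sdiff.1 hm).1)]; ring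

/-- The degree of a link in the target splits into the plaquettes already born and those born at its block. [folklore] -/
theorem card_atLink_split {e : ZdEdge 4} {X : Finset (ZdPlaquette 4)} {s : State} (hI : Inv e X s) (l : ZdEdge 4) :
    (atLink X l).card = (atLink s.Y l).card + (atLink (X \ s.Y) l).card := by
  rw [← card_union_of_disjoint (disjoint_filter_filter disjoint_sdiff)]
  congr 1
  rw [← filter_union, union_sdiff_of_subset hI.sub]

/-- **Lower bound along the run.** For an `Adm`-connected target closed on its admissible links, through the root link `e`, from any state satisfying the
invariant and with enough fuel, `x^U · y^Φ ≤ wt · y^U` (i.e. `wt ≥ x^{unborn} y^{Φ − unborn}`): every indicator is `1` by closedness (only admissible links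
are decided), the run ends with everything born by `Adm`-connectedness, and the exponents telescope (`U_step`, `Φ_step`). [folklore] -/
theorem wt_lower {e : ZdEdge 4} {X : Finset (ZdPlaquette 4)} (hclosed : AdmClosed Adm X) (hconn : IsAdmConnected Adm X) (hroot : e ∈ links X) :
    ∀ (k : ℕ) (s : State), Inv e X s → μ Adm X s ≤ k → xK ^ U X s * yK ^ Φ X s ≤ wt Adm k s X * yK ^ U X s := by
  have hterm : ∀ (k : ℕ) (s : State), Inv e X s → und Adm s = ∅ → xK ^ U X s * yK ^ Φ X s ≤ wt Adm k s X * yK ^ U X s := by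
    intro k s hI h
    have hYX : s.Y = X := eq_of_terminal Adm hI hconn hroot h
    have hU : U X s = 0 := by unfold U; rw [hYX, Finset.sdiff_self, card_empty]
    rw [wt_terminal Adm h, if_pos hYX, hU, pow_zero, pow_zero, one_mul, one_mul]
    exact pow_le_one₀ yK_pos.le yK_le_one
  intro k
  induction k with
  | zero =>
    intro s hI hμ
    by_cases h : und Adm s = ∅
    · exact hterm 0 s hI h
    · exfalso
      have : 0 < μ Adm X s := card_pos.2 ⟨_, sel_mem_sdiff Adm hI h⟩
      omega
  | succ k ih =>
    intro s hI hμ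
    by_cases h : und Adm s = ∅
    · exact hterm (k + 1) s hI h
    · have hμ' : μ Adm X (step Adm s X) ≤ k := by have := μ_step Adm hI h; omega
      have hI' := inv_step Adm hI (X := X)
      have hrec := ih (step Adm s X) hI' hμ'
      set l := sel (und Adm s) with hl
      set c := (atLink s.Y l).card with hc
      set m := (atLink (X \ s.Y) l).card with hm
      have hdeg : 2 ≤ c + m := by
        rw [hc, hm, ← card_atLink_split hI l]
        have hsel := mem_sdiff.1 (sel_mem_sdiff Adm hI h)
        exact hclosed l (mem_filter.1 hsel.1).1 (mem_filter.1 hsel.1).2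
      have hbw : bw c m = xK ^ m * yK ^ c := by unfold bw; rw [if_pos hdeg]
      have hU : U X s = m + U X (step Adm s X) := U_step Adm
      have hΦ : Φ X s = (c + m) + Φ X (step Adm s X) := by rw [Φ_step Adm hI h, card_atLink_split hI l]
      rw [wt_succ Adm h, ← hl, ← hc, ← hm, hbw, hU, hΦ]
      have hx := xK_pos
      have hy := yK_pos
      calc xK ^ (m + U X (step Adm s X)) * yK ^ (c + m + Φ X (step Adm s X))
          = (xK ^ m * yK ^ c * yK ^ m) * (xK ^ U X (step Adm s X) * yK ^ Φ X (step Adm s X)) := by ring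
        _ ≤ (xK ^ m * yK ^ c * yK ^ m) * (wt Adm k (step Adm s X) X * yK ^ U X (step Adm s X)) :=
            mul_le_mul_of_nonneg_left hrec (by positivity)
        _ = xK ^ m * yK ^ c * wt Adm k (step Adm s X) X * yK ^ (m + U X (step Adm s X)) := by ring

/-- The initial state satisfies the invariant. [folklore] -/
theorem inv_init (e : ZdEdge 4) (X : Finset (ZdPlaquette 4)) : Inv e X (init e X) :=
  ⟨filter_subset _ _, fun l hl => by rw [mem_singleton.1 hl]; exact Subset.rfl, mem_singleton_self _⟩

/-- A plaquette set has at most four links per plaquette. [folklore] -/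
theorem card_links_le (X : Finset (ZdPlaquette 4)) : (links X).card ≤ 4 * X.card := by
  unfold links
  refine card_biUnion_le.trans ?_
  calc ∑ p ∈ X, (plaquetteEdges p).card ≤ ∑ _p ∈ X, 4 := sum_le_sum fun p _ => card_plaquetteEdges_le p
    _ = 4 * X.card := by rw [sum_const, smul_eq_mul, mul_comm]

/-- The initial potential: `Φ(init e X) + m₀ ≤ 4n` (`m₀` = plaquettes of `X` at the root link). [folklore] -/
theorem Φ_init_le (e : ZdEdge 4) (X : Finset (ZdPlaquette 4)) : Φ X (init e X) + (atLink X e).card ≤ 4 * X.card := by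
  unfold Φ init
  change ∑ p ∈ X, (plaquetteEdges p \ {e}).card + (atLink X e).card ≤ _
  rw [card_filter, ← sum_add_distrib]
  calc ∑ p ∈ X, ((plaquetteEdges p \ {e}).card + if e ∈ plaquetteEdges p then 1 else 0)
      = ∑ p ∈ X, (plaquetteEdges p).card := by
        refine sum_congr rfl fun p _ => ?_
        rw [sdiff_singleton_eq_erase]
        by_cases hp : e ∈ plaquetteEdges p
        · rw [if_pos hp, card_erase_add_one hp]
        · rw [if_neg hp, erase_eq_of_notMem hp, add_zero]
    _ ≤ ∑ _p ∈ X, 4 := sum_le_sum fun p _ => card_plaquetteEdges_le p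
    _ = 4 * X.card := by rw [sum_const, smul_eq_mul, mul_comm]

/-- **The weight of an `Adm`-connected `n`-complex closed on its admissible links, through the admissible root link `e`, is at least `x^n y^{3n}`.**
[folklore] -/
theorem W_lower {e : ZdEdge 4} (he : Adm e) {n : ℕ} {X : Finset (ZdPlaquette 4)} (hcard : X.card = n) (hroot : e ∈ links X)
    (hconn : IsAdmConnected Adm X) (hclosed : AdmClosed Adm X) : xK ^ n * yK ^ (3 * n) ≤ W Adm e n X := by
  have hx := xK_pos
  have hy := yK_pos
  set m₀ := (atLink X e).card with hm₀
  have hm₀n : m₀ ≤ n := hcard ▸ card_le_card (filter_subset _ _)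
  have hdeg : 2 ≤ 0 + m₀ := by rw [zero_add]; exact hclosed _ hroot he
  have hbw : bw 0 m₀ = xK ^ m₀ := by unfold bw; rw [if_pos hdeg, pow_zero, mul_one]
  have hU : U X (init e X) = n - m₀ := by
    unfold U init
    rw [card_sdiff_of_subset (filter_subset _ _), hcard]
  have hμ : μ Adm X (init e X) ≤ 4 * n := by
    have h4 : (links X).card ≤ 4 * n := by rw [← hcard]; exact card_links_le X
    unfold μ
    exact (card_le_card sdiff_subset).trans ((card_le_card (filter_subset _ _)).trans h4)
  have hΦ : Φ X (init e X) ≤ 3 * n + (n - m₀) := by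
    have := Φ_init_le e X
    rw [hcard, ← hm₀] at this
    omega
  have hrun := wt_lower Adm hclosed hconn hroot (4 * n) (init e X) (inv_init e X) hμ
  rw [hU] at hrun
  -- `x^{n−m₀} y^{Φ} ≤ wt · y^{n−m₀}` and `Φ ≤ 3n + (n − m₀)`
  have h1 : xK ^ (n - m₀) * yK ^ (3 * n + (n - m₀)) ≤ wt Adm (4 * n) (init e X) X * yK ^ (n - m₀) :=
    (mul_le_mul_of_nonneg_left (pow_le_pow_of_le_one hy.le yK_le_one hΦ) (by positivity)).trans hrun
  have h2 : (xK ^ n * yK ^ (3 * n)) * yK ^ (n - m₀) ≤ W Adm e n X * yK ^ (n - m₀) := by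
    unfold W
    rw [← hm₀, hbw]
    calc (xK ^ n * yK ^ (3 * n)) * yK ^ (n - m₀) = xK ^ m₀ * (xK ^ (n - m₀) * yK ^ (3 * n + (n - m₀))) := by
          have hxn : xK ^ n = xK ^ m₀ * xK ^ (n - m₀) := by rw [← pow_add, Nat.add_sub_cancel' hm₀n]
          rw [hxn, pow_add]; ring
      _ ≤ xK ^ m₀ * (wt Adm (4 * n) (init e X) X * yK ^ (n - m₀)) := mul_le_mul_of_nonneg_left h1 (by positivity)
      _ = xK ^ m₀ * wt Adm (4 * n) (init e X) X * yK ^ (n - m₀) := by ring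
  exact le_of_mul_le_mul_right h2 (by positivity)

/-! ## §4 ★ The tail bound for every admissibility class, and the discharge of `TailBoundT2` -/

open Classical in
/-- The finite family of `Adm`-connected `n`-complexes through `e` closed on their admissible links (a filter of `AdmissibleLinkComplexCount.dfsFamilyAt e n`).
[folklore] -/
def validFamily (e : ZdEdge 4) (n : ℕ) : Finset (Finset (ZdPlaquette 4)) :=
  (dfsFamilyAt e n).filter fun X => X.card = n ∧ e ∈ links X ∧ IsAdmConnected Adm X ∧ AdmClosed Adm X

omit [DecidablePred Adm] in
open Classical in
/-- Membership in the valid family is validity. [folklore] -/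
theorem mem_validFamily {e : ZdEdge 4} {n : ℕ} {X : Finset (ZdPlaquette 4)} :
    X ∈ validFamily Adm e n ↔ X.card = n ∧ e ∈ links X ∧ IsAdmConnected Adm X ∧ AdmClosed Adm X := by
  unfold validFamily
  rw [mem_filter]
  exact ⟨fun h => h.2, fun h => ⟨mem_dfsFamilyAt h.1 h.2.1 (isLinkConnected_of_isAdmConnected h.2.2.1), h⟩⟩

omit [DecidablePred Adm] in
/-- The count of `Adm`-connected `n`-complexes through `e` closed on their admissible links is the cardinality of the valid family. [folklore] -/
theorem admClosedCount_eq_card (e : ZdEdge 4) (n : ℕ) :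
    Nat.card {X : Finset (ZdPlaquette 4) // X.card = n ∧ e ∈ links X ∧ IsAdmConnected Adm X ∧ AdmClosed Adm X} = (validFamily Adm e n).card := by
  have hset : {X : Finset (ZdPlaquette 4) | X.card = n ∧ e ∈ links X ∧ IsAdmConnected Adm X ∧ AdmClosed Adm X} =
      (↑(validFamily Adm e n) : Set (Finset (ZdPlaquette 4))) := by
    ext X
    rw [Set.mem_setOf_eq, mem_coe, mem_validFamily]
  calc Nat.card {X : Finset (ZdPlaquette 4) // X.card = n ∧ e ∈ links X ∧ IsAdmConnected Adm X ∧ AdmClosed Adm X}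
      = ({X : Finset (ZdPlaquette 4) | X.card = n ∧ e ∈ links X ∧ IsAdmConnected Adm X ∧ AdmClosed Adm X}).ncard := Nat.card_coe_set_eq _
    _ = (↑(validFamily Adm e n) : Set (Finset (ZdPlaquette 4))).ncard := by rw [hset]
    _ = (validFamily Adm e n).card := Set.ncard_coe_finset _

/-- ★ **The Kraft tail bound for every admissibility class**: `count · x^n y^{3n} ≤ 7/10` through an admissible root link. [folklore] -/
theorem admClosedCount_mul_le {e : ZdEdge 4} (he : Adm e) (n : ℕ) :
    (Nat.card {X : Finset (ZdPlaquette 4) // X.card = n ∧ e ∈ links X ∧ IsAdmConnected Adm X ∧ AdmClosed Adm X} : ℝ) * (xK ^ n * yK ^ (3 * n)) ≤ 7 / 10 := by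
  rw [admClosedCount_eq_card, ← nsmul_eq_mul, ← sum_const]
  refine (sum_le_sum fun X hX => ?_).trans (kraft_root_sum Adm e n (validFamily Adm e n))
  obtain ⟨hcard, hroot, hconn, hclosed⟩ := (mem_validFamily Adm).1 hX
  exact W_lower Adm he hcard hroot hconn hclosed

/-- ★ **T2′ (every admissibility class)**: through an admissible root link, the `Adm`-connected `n`-complexes closed on their admissible links number
`≤ (7/10)·((100/19)·(119/100)^6)^n = 0.7·(14.9461…)^n`. [folklore] -/
theorem admClosedCount_le_kraft {e : ZdEdge 4} (he : Adm e) (n : ℕ) :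
    (Nat.card {X : Finset (ZdPlaquette 4) // X.card = n ∧ e ∈ links X ∧ IsAdmConnected Adm X ∧ AdmClosed Adm X} : ℝ) ≤
      7 / 10 * ((100 / 19) * (119 / 100 : ℝ) ^ 6) ^ n := by
  have h := admClosedCount_mul_le Adm he n
  have hxy : xK ^ n * yK ^ (3 * n) = (((100 / 19) * (119 / 100 : ℝ) ^ 6) ^ n)⁻¹ := by
    rw [pow_mul, ← mul_pow, ← inv_pow]
    congr 1
    unfold xK yK; norm_num
  rw [hxy] at h
  have hpos : 0 < ((100 / 19) * (119 / 100 : ℝ) ^ 6) ^ n := by positivity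
  rwa [← div_eq_mul_inv, div_le_iff₀ hpos] at h

/-- ★ **T2′ (every admissibility class), printed constant**: `≤ (7/10)·(299/20)^n = 0.7·14.95ⁿ`. [folklore] -/
theorem admClosedCount_le_T2 {e : ZdEdge 4} (he : Adm e) (n : ℕ) :
    (Nat.card {X : Finset (ZdPlaquette 4) // X.card = n ∧ e ∈ links X ∧ IsAdmConnected Adm X ∧ AdmClosed Adm X} : ℝ) ≤ 7 / 10 * (299 / 20 : ℝ) ^ n :=
  (admClosedCount_le_kraft Adm he n).trans
    (mul_le_mul_of_nonneg_left (pow_le_pow_left₀ (by positivity) (by norm_num) n) (by norm_num))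

/-- Link-connected = connected through ALL links (`Adm = ⊤`). [folklore] -/
theorem isAdmConnected_top_iff (X : Finset (ZdPlaquette 4)) : IsAdmConnected (fun _ => True) X ↔ IsLinkConnected X := by
  have hR : (fun a b : ZdPlaquette 4 => a ∈ X ∧ b ∈ X ∧ ∃ l, (fun _ : ZdEdge 4 => True) l ∧ l ∈ plaquetteEdges a ∧ l ∈ plaquetteEdges b) =
      (fun a b : ZdPlaquette 4 => a ∈ X ∧ b ∈ X ∧ ¬ Disjoint (plaquetteEdges a) (plaquetteEdges b)) := by
    ext a b
    simp only [true_and, not_disjoint_iff]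
  unfold IsAdmConnected IsLinkConnected
  rw [hR]

/-- Closed = closed on ALL links (`Adm = ⊤`). [folklore] -/
theorem admClosed_top_iff (X : Finset (ZdPlaquette 4)) : AdmClosed (fun _ => True) X ↔ IsClosedComplex X :=
  ⟨fun h l hl => h l hl trivial, fun h l hl _ => h l hl⟩

/-- `closedCount 4 n` is the `Adm = ⊤`, `e = rootLink 4` count. [folklore] -/
theorem closedCount_eq_admClosedCount (n : ℕ) : closedCount 4 n =
    Nat.card {X : Finset (ZdPlaquette 4) // X.card = n ∧ rootLink 4 ∈ links X ∧ IsAdmConnected (fun _ => True) X ∧ AdmClosed (fun _ => True) X} := by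
  unfold closedCount
  exact Nat.card_congr (Equiv.subtypeEquivRight fun X => by rw [isAdmConnected_top_iff, admClosed_top_iff])

/-- ★ `closedCount 4 n ≤ (7/10)·((100/19)·(119/100)^6)^n = 0.7·(14.9461…)^n` for every `n`. [folklore] -/
theorem closedCount_four_le_kraft (n : ℕ) : (closedCount 4 n : ℝ) ≤ 7 / 10 * ((100 / 19) * (119 / 100 : ℝ) ^ 6) ^ n := by
  rw [closedCount_eq_admClosedCount]
  exact admClosedCount_le_kraft (fun _ => True) trivial n

/-- ★ `closedCount 4 n ≤ (7/10)·(299/20)^n = 0.7·14.95ⁿ` for every `n` (`(100/19)·(1.19)^6 = 14.9461… ≤ 14.95`). [folklore] -/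
theorem closedCount_four_le_T2 (n : ℕ) : (closedCount 4 n : ℝ) ≤ 7 / 10 * (299 / 20 : ℝ) ^ n := by
  rw [closedCount_eq_admClosedCount]
  exact admClosedCount_le_T2 (fun _ => True) trivial n

/-- ★★ **The tree's tail obligation `TailBoundT2` DISCHARGED** (hypothesis-free): for every `n ≥ 2`, `closedCount 4 n ≤ (7/10)·(299/20)^n`.
[folklore] -/
theorem tailBoundT2_holds : TailBoundT2 := fun n _ => closedCount_four_le_T2 n

end Summit.QuantumFields.YangMills.Theorems.Instrument.ClosedComplexTailBound

end
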